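/-
Copyright (c) 2026 the pub-hodgecm-mathlib formalisation cell (harness21).  Prover seat hodgecm-mathlib-LH6-p04 (g11), 2026-09-03.  E1 item (U7) «GEODESIC INCLUSION»
(E1 keeper ∕ dealer F0P3a-p03 (g29); ledger v5 rows 39α–δ), FILE δ «TRANSPORT + (U7) FROM AN APARTMENT WITNESS» (over ★ β `UnitaryLatticeTreeUnitaryGauss`).
-/
import Literature.NumberTheory.Automorphic.UnitaryLatticeTreeUnitaryGauss        -- ★ FILE β (LH6-p04 g11): `unitaryLevel_subset_mul_of_between`, apartment weights; brings ★ α, ★ 39β-gen, ★ Defs (`mapGL`, `latticeGraph`, `IsVertex`)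
import Literature.NumberTheory.Automorphic.UnitaryLatticeTreeGeodesicApartment  -- ★ FILE γ (F0P3a-p01 g23): `exists_apartmentEnum`, `exists_latticeGraphIso_apartmentEnum_of_adj_of_dist` (every geodesic lies in a translate of the apartment)
import Literature.NumberTheory.Automorphic.UnitaryLatticeTreeFrameChange       -- ★ `mapGL_conj_mapGL_eq_iff` (`(TgT⁻¹)·(T·M) = T·M ↔ g·M = M`, reused — not restated)
import HarnessLib

/-!
# The lattice graph of a hermitian space — (U7) GEODESIC INCLUSION `U_y ⊆ U_x · U_z` for the neighbour `y` of `x` on the geodesic `[x, z]` of the unramified `U(3)` tree ([SS97] Prop. I.3.1, lattice model):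
# TRANSPORT of unitary level groups under `U(σ, Φ₃)`, the inclusion FROM AN APARTMENT WITNESS (★ β), and the HEAD in row 34's letters (witness from ★ γ `UnitaryLatticeTreeGeodesicApartment`)

Topic `NumberTheory/Automorphic`; namespace `Literature.NumberTheory.Automorphic.UnitaryLatticeTree` (T1a currency of ★ `UnitaryLatticeTreeDefs`).  THEOREMS ONLY (no definition,
no instance, no notation, no named fact, no `sorry`); kernel lane.  Cell `pub/hodgecm-mathlib` (D-0151), crux H413 = `stmt-HodgeConjecture-24833`; E1 item (U7) (keeper
F0P3a-p03 (g29)), file δ (α ★ `UnitaryLatticeTreeWeightedGauss`, β-gen ★ `UnitaryGaussFactorsDescend` (LH5-p05), β ★ `UnitaryLatticeTreeUnitaryGauss`, γ `UnitaryLatticeTreeGeodesicApartment`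
(F0P3a-p01); the row-34 `hU7` HEAD — γ's geodesic witness plugged into §2 here — is the short sequel).  HONEST LABEL: count-neutral generic base layer of the (R-SS) resolution
engine (census E1 v1 §1–§2); (R-SS) NOT chartered; HC_CM is proved only modulo the 2 remaining named inputs (hLiu418 24832, h413 24833) until rung 0 closes; nothing printed is
asserted here.

THE MATHEMATICS.  `K` a field with `Valued K ℤᵐ⁰`, `σ : K →+* K`, `Φ₃ = antidiag(1,1,1)`; the UNITARY LEVEL GROUP of a lattice `M` at level `c`, hypothesis-style as in rows 22∕22b∕β:
`g ∈ U_M ↔ g ∈ U(σ,Φ₃) ∧ g·M = M ∧ (g − 1)·M ⊆ c·M` (inline token `M.map (toLin' (g − 1)) ≤ scaleLattice c M`).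
* §1 TRANSPORT (any `N`, any form `H`): `(hgh⁻¹ − 1)·(h·M) = h·((g − 1)·M)`, so the level token and the stabiliser clause of `hgh⁻¹` on `h·M` are those of `g` on `M`; hence
  `U_{h·M} = h U_M h⁻¹` for unitary `h` (membership form: `g ∈ U_{h·M} ↔ h⁻¹gh ∈ U_M`), and an inclusion `U_{M₂} ⊆ U_{M₁}·U_{M₃}` transports to `U_{h·M₂} ⊆ U_{h·M₁}·U_{h·M₃}`.
* §2 **(U7) FROM AN APARTMENT WITNESS**: if `x = h·A(i)`, `y = h·A(j)`, `z = h·A(k)` with `h ∈ U(σ,Φ₃)` and `j` between `i` and `k` (`A(m) = latt diag(ϖ^{⌊(m+1)/2⌋}, 1, ϖ^{−⌊m/2⌋})`,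
  the standard apartment of ★ β §3), then `U_y ⊆ U_x · U_z` for every family of unitary level groups on the vertices of the lattice graph at any level `0 < |c| < 1`
  (★ β `unitaryLevel_subset_mul_of_between` on the pulled-back groups `(U_x).comap (conj h)`, then §1).
* §3 THE SUBTYPE FORM: the same inclusion for subgroups of the subtype group `↥U(σ, J)` (`J = Φ₃` as a hypothesis `hJ`, the currency of ★ `borelTriple` ∕ the datum
  `Gqs L v = ↥(unitaryGroupOfForm … (cmLocalForm L 3 v))`, ★ `cmDatum_Local_eq` + `cmLocalForm_eq_over`).
* §4 **THE HEAD (row 34's `hU7`, [Korman2004 §3.6 (U7)])**: under `UnramifiedLocalConjDatum σ ϖ`, for every family `U` of unitary level groups on the vertices of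
  `latticeGraph σ ϖ Φ₃` at a level `0 < |c| < 1` (row 22: `c = ϖ^(e+1)`): `G.Adj x y → G.dist y z + 1 = G.dist x z → ↑(U y) ⊆ ↑(U x) * ↑(U z)` — ★ γ supplies
  `u ∈ U(σ,Φ₃)`, `i + 1 ≤ k` with `(x, y, z) = u·(A i, A (i+1), A k)`, §2 concludes; also in the subtype form (§3).

## References
* [SchneiderStuhler1997] P. Schneider, U. Stuhler, *Representation theory and sheaves on the Bruhat–Tits building*, Publ. Math. IHÉS 85 (1997): Ch. I §2 (U3) (`P_F†` normalises
  `U_F^{(e)}`), Prop. I.3.1 p. 118 (`U_z^{(e)} ⊆ U_x^{(e)} U_{x′}^{(e)}` for `z ∈ [x, x′]`; remark: any vertex `x`).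
* [BruhatTits1972] F. Bruhat, J. Tits, *Groupes réductifs sur un corps local* I, Publ. Math. IHÉS 41 (1972): §10, (7.4.18) (two facets lie in a common apartment).
* [Korman2004] J. Korman, *On the local constancy of characters*, arXiv:math/0409292: §3.6 (U7).
-/

set_option autoImplicit false

noncomputable section

open scoped Valued WithZero Matrix MatrixGroups Pointwise

namespace Literature.NumberTheory.Automorphic.UnitaryLatticeTree

open Literature.NumberTheory.Automorphic Literature.NumberTheory.Automorphic.HermitianLattice Literature.NumberTheory.Automorphic.UnitaryGroup
open Literature.NumberTheory.Automorphic.CartanUnique (uniformizer_ne_zero v_uniformizer_zpow)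

variable {K : Type*} [Field K] [Valued K ℤᵐ⁰] (σ : K →+* K) {N : ℕ}

/-! ## §1 Transport of the level token, the stabiliser clause and the unitary level groups under `g ↦ hgh⁻¹`, `M ↦ h·M` -/

omit [Valued K ℤᵐ⁰] in
/-- The matrix identity `(hgh⁻¹ − 1)·h = h·(g − 1)`. [cite: SchneiderStuhler1997, Ch. I §2 (U3)] -/
theorem conj_sub_one_mul (h g : GL (Fin N) K) :
    (((h * g * h⁻¹ : GL (Fin N) K) : Matrix (Fin N) (Fin N) K) - 1) * (h : Matrix (Fin N) (Fin N) K) = (h : Matrix (Fin N) (Fin N) K) * ((g : Matrix (Fin N) (Fin N) K) - 1) := by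
  rw [Matrix.sub_mul, Matrix.mul_sub, Matrix.one_mul, Matrix.mul_one, Units.val_mul, Units.val_mul, Matrix.mul_assoc, Matrix.mul_assoc, ← Units.val_mul, inv_mul_cancel,
    Units.val_one, Matrix.mul_one]

/-- `(hgh⁻¹ − 1)·(h·M) = h·((g − 1)·M)`. [cite: SchneiderStuhler1997, Ch. I §2 (U3)] -/
theorem mapGL_map_conj_sub_one (h g : GL (Fin N) K) (M : Submodule 𝒪[K] (Fin N → K)) :
    (mapGL h M).map ((Matrix.toLin' (((h * g * h⁻¹ : GL (Fin N) K) : Matrix (Fin N) (Fin N) K) - 1)).restrictScalars 𝒪[K]) =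
      mapGL h (M.map ((Matrix.toLin' ((g : Matrix (Fin N) (Fin N) K) - 1)).restrictScalars 𝒪[K])) := by
  rw [mapGL, mapGL, ← Submodule.map_comp, ← Submodule.map_comp]
  congr 1
  apply LinearMap.ext
  intro x
  simp only [LinearMap.coe_comp, Function.comp_apply, LinearMap.restrictScalars_apply, Matrix.toLin'_apply, Matrix.mulVec_mulVec, conj_sub_one_mul]

/-- **TRANSPORT OF THE LEVEL TOKEN**: `hgh⁻¹` has level `c` on `h·M` iff `g` has level `c` on `M`. [cite: SchneiderStuhler1997, Ch. I §2 (U3)] -/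
theorem map_conj_sub_one_le_scaleLattice_mapGL_iff (h g : GL (Fin N) K) (c : K) (M : Submodule 𝒪[K] (Fin N → K)) :
    (mapGL h M).map ((Matrix.toLin' (((h * g * h⁻¹ : GL (Fin N) K) : Matrix (Fin N) (Fin N) K) - 1)).restrictScalars 𝒪[K]) ≤ scaleLattice c (mapGL h M) ↔
      M.map ((Matrix.toLin' ((g : Matrix (Fin N) (Fin N) K) - 1)).restrictScalars 𝒪[K]) ≤ scaleLattice c M := by
  rw [mapGL_map_conj_sub_one, ← mapGL_scaleLattice, mapGL_le_mapGL_iff]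

omit [Valued K ℤᵐ⁰] in
/-- `h (h⁻¹ g h) h⁻¹ = g` in any group. [cite: SchneiderStuhler1997, Ch. I §2 (U3)] -/
theorem conj_inv_conj {G : Type*} [Group G] (h g : G) : h * (h⁻¹ * g * h) * h⁻¹ = g := by group

omit [Valued K ℤᵐ⁰] in
/-- `h⁻¹ (h g h⁻¹) h = g` in any group. [cite: SchneiderStuhler1997, Ch. I §2 (U3)] -/
theorem inv_conj_conj {G : Type*} [Group G] (h g : G) : h⁻¹ * (h * g * h⁻¹) * h = g := by group

/-- **TRANSPORT OF THE UNITARY LEVEL GROUP** (membership form): for `h ∈ U(σ, H)` and hypothesis-style unitary level groups `U_M` of `M` and `U′` of `h·M` at the same level,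
`g ∈ U′ ↔ h⁻¹gh ∈ U_M` — i.e. `U_{h·M} = h U_M h⁻¹`. [cite: SchneiderStuhler1997, Ch. I §2 (U3)] -/
theorem mem_unitaryLevel_mapGL_iff {H : Matrix (Fin N) (Fin N) K} {h : GL (Fin N) K} (hh : h ∈ unitaryGroupOfForm σ H) {c : K} {M : Submodule 𝒪[K] (Fin N → K)}
    {UM U' : Subgroup (GL (Fin N) K)}
    (hUM : ∀ g : GL (Fin N) K, g ∈ UM ↔ g ∈ unitaryGroupOfForm σ H ∧ mapGL g M = M ∧ M.map ((Matrix.toLin' ((g : Matrix (Fin N) (Fin N) K) - 1)).restrictScalars 𝒪[K]) ≤ scaleLattice c M)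
    (hU' : ∀ g : GL (Fin N) K, g ∈ U' ↔ g ∈ unitaryGroupOfForm σ H ∧ mapGL g (mapGL h M) = mapGL h M ∧
      (mapGL h M).map ((Matrix.toLin' ((g : Matrix (Fin N) (Fin N) K) - 1)).restrictScalars 𝒪[K]) ≤ scaleLattice c (mapGL h M))
    (g : GL (Fin N) K) : g ∈ U' ↔ h⁻¹ * g * h ∈ UM := by
  rw [hU' g, hUM (h⁻¹ * g * h)]
  conv_lhs => rw [← conj_inv_conj h g]
  rw [map_conj_sub_one_le_scaleLattice_mapGL_iff, mapGL_conj_mapGL_eq_iff]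
  refine and_congr ?_ Iff.rfl
  rw [conj_inv_conj]
  constructor
  · intro hg; exact Subgroup.mul_mem _ (Subgroup.mul_mem _ (Subgroup.inv_mem _ hh) hg) hh
  · intro hg
    have := Subgroup.mul_mem _ (Subgroup.mul_mem _ hh hg) (Subgroup.inv_mem _ hh)
    rwa [conj_inv_conj] at this

omit [Valued K ℤᵐ⁰] in
/-- **TRANSPORT OF A PRODUCT INCLUSION**: if `g ∈ Vₘ ↔ h⁻¹gh ∈ Uₘ` (`m = 1, 2, 3`) then `U₂ ⊆ U₁·U₃ ⇒ V₂ ⊆ V₁·V₃` (conjugation is a group automorphism).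
[cite: SchneiderStuhler1997, Ch. I Prop. I.3.1 p. 118] -/
theorem subset_mul_of_forall_mem_iff_conj_mem {G : Type*} [Group G] (h : G) {U₁ U₂ U₃ V₁ V₂ V₃ : Subgroup G}
    (h1 : ∀ g, g ∈ V₁ ↔ h⁻¹ * g * h ∈ U₁) (h2 : ∀ g, g ∈ V₂ ↔ h⁻¹ * g * h ∈ U₂) (h3 : ∀ g, g ∈ V₃ ↔ h⁻¹ * g * h ∈ U₃)
    (hsub : (U₂ : Set G) ⊆ (U₁ : Set G) * (U₃ : Set G)) : (V₂ : Set G) ⊆ (V₁ : Set G) * (V₃ : Set G) := by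
  intro g hg
  obtain ⟨a, ha, b, hb, hab⟩ := Set.mem_mul.1 (hsub ((h2 g).1 hg))
  refine Set.mem_mul.2 ⟨h * a * h⁻¹, (h1 _).2 (by rw [inv_conj_conj]; exact ha), h * b * h⁻¹, (h3 _).2 (by rw [inv_conj_conj]; exact hb), ?_⟩
  calc h * a * h⁻¹ * (h * b * h⁻¹) = h * (a * b) * h⁻¹ := by group
    _ = g := by rw [hab, conj_inv_conj]


/-! ## §2 (U7) from an apartment witness: `x = h·A(i)`, `y = h·A(j)`, `z = h·A(k)`, `j` between `i` and `k` ⇒ `U_y ⊆ U_x · U_z` -/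

/-- **(U7) FROM AN APARTMENT WITNESS** ([SS97] Prop. I.3.1 in the lattice model of the `U(3)` tree): let `U` assign to every vertex `x` of the lattice graph of `(K³, Φ₃)` its
unitary level group at level `c` (`0 < |c| < 1`; hypothesis-style `hU`).  If `x = h·A(i)`, `y = h·A(j)`, `z = h·A(k)` for some `h ∈ U(σ, Φ₃)` and `i ≤ j ≤ k` or `k ≤ j ≤ i`
(`A(m) = latt diag(ϖ^{⌊(m+1)/2⌋}, 1, ϖ^{−⌊m/2⌋})`), then `U_y ⊆ U_x · U_z` (★ β on the pulled-back groups `(U_x).comap (conj h)`, transported back by §1).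
[cite: SchneiderStuhler1997, Ch. I Prop. I.3.1 p. 118] [cite: BruhatTits1972, §10] [cite: Korman2004, §3.6] -/
theorem unitaryLevel_subset_mul_of_apartment_witness {ϖ : K} (hϖ : Valued.v ϖ = WithZero.exp (-1 : ℤ)) {c : K} (hc0 : c ≠ 0) (hc1 : Valued.v c < 1)
    (U : {M : Submodule 𝒪[K] (Fin 3 → K) // IsVertex σ ϖ ((StdForm.antidiagonal 3).over K) M} → Subgroup (GL (Fin 3) K))
    (hU : ∀ (x : {M : Submodule 𝒪[K] (Fin 3 → K) // IsVertex σ ϖ ((StdForm.antidiagonal 3).over K) M}) (g : GL (Fin 3) K),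
      g ∈ U x ↔ g ∈ unitaryGroupOfForm σ ((StdForm.antidiagonal 3).over K) ∧ mapGL g x.1 = x.1 ∧
        x.1.map ((Matrix.toLin' ((g : Matrix (Fin 3) (Fin 3) K) - 1)).restrictScalars 𝒪[K]) ≤ scaleLattice c x.1)
    {x y z : {M : Submodule 𝒪[K] (Fin 3 → K) // IsVertex σ ϖ ((StdForm.antidiagonal 3).over K) M}}
    {h : GL (Fin 3) K} (hh : h ∈ unitaryGroupOfForm σ ((StdForm.antidiagonal 3).over K)) {i j k : ℤ} (hijk : i ≤ j ∧ j ≤ k ∨ k ≤ j ∧ j ≤ i)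
    (hx : x.1 = mapGL h (latt (Matrix.diagonal ![ϖ ^ ((i + 1) / 2), (1 : K), ϖ ^ (-(i / 2))])))
    (hy : y.1 = mapGL h (latt (Matrix.diagonal ![ϖ ^ ((j + 1) / 2), (1 : K), ϖ ^ (-(j / 2))])))
    (hz : z.1 = mapGL h (latt (Matrix.diagonal ![ϖ ^ ((k + 1) / 2), (1 : K), ϖ ^ (-(k / 2))]))) :
    (U y : Set (GL (Fin 3) K)) ⊆ (U x : Set (GL (Fin 3) K)) * (U z : Set (GL (Fin 3) K)) := by
  -- the pulled-back groups `V m := (U ·).comap (conj h)` are the unitary level groups of the apartment lattices `A m`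
  have hmem : ∀ (w : {M : Submodule 𝒪[K] (Fin 3 → K) // IsVertex σ ϖ ((StdForm.antidiagonal 3).over K) M}) (m : ℤ),
      w.1 = mapGL h (latt (Matrix.diagonal ![ϖ ^ ((m + 1) / 2), (1 : K), ϖ ^ (-(m / 2))])) →
      ∀ g : GL (Fin 3) K, g ∈ (U w).comap (MulAut.conj h).toMonoidHom ↔
        g ∈ unitaryGroupOfForm σ ((StdForm.antidiagonal 3).over K) ∧
          mapGL g (latt (Matrix.diagonal ![ϖ ^ ((m + 1) / 2), (1 : K), ϖ ^ (-(m / 2))])) = latt (Matrix.diagonal ![ϖ ^ ((m + 1) / 2), (1 : K), ϖ ^ (-(m / 2))]) ∧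
          (latt (Matrix.diagonal ![ϖ ^ ((m + 1) / 2), (1 : K), ϖ ^ (-(m / 2))])).map ((Matrix.toLin' ((g : Matrix (Fin 3) (Fin 3) K) - 1)).restrictScalars 𝒪[K]) ≤
            scaleLattice c (latt (Matrix.diagonal ![ϖ ^ ((m + 1) / 2), (1 : K), ϖ ^ (-(m / 2))])) := by
    intro w m hw g
    rw [Subgroup.mem_comap, MulEquiv.coe_toMonoidHom, MulAut.conj_apply]
    have hU'w : ∀ g' : GL (Fin 3) K, g' ∈ U w ↔ g' ∈ unitaryGroupOfForm σ ((StdForm.antidiagonal 3).over K) ∧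
        mapGL g' (mapGL h (latt (Matrix.diagonal ![ϖ ^ ((m + 1) / 2), (1 : K), ϖ ^ (-(m / 2))]))) =
          mapGL h (latt (Matrix.diagonal ![ϖ ^ ((m + 1) / 2), (1 : K), ϖ ^ (-(m / 2))])) ∧
        (mapGL h (latt (Matrix.diagonal ![ϖ ^ ((m + 1) / 2), (1 : K), ϖ ^ (-(m / 2))]))).map
            ((Matrix.toLin' ((g' : Matrix (Fin 3) (Fin 3) K) - 1)).restrictScalars 𝒪[K]) ≤
          scaleLattice c (mapGL h (latt (Matrix.diagonal ![ϖ ^ ((m + 1) / 2), (1 : K), ϖ ^ (-(m / 2))]))) := by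
      intro g'; rw [hU w g', hw]
    obtain ⟨S, hS⟩ := exists_subgroup_mem_iff_mapGL_eq_and_map_sub_one_le_scaleLattice c (latt (Matrix.diagonal ![ϖ ^ ((m + 1) / 2), (1 : K), ϖ ^ (-(m / 2))]))
    have hUM : ∀ g' : GL (Fin 3) K, g' ∈ unitaryGroupOfForm σ ((StdForm.antidiagonal 3).over K) ⊓ S ↔
        g' ∈ unitaryGroupOfForm σ ((StdForm.antidiagonal 3).over K) ∧
          mapGL g' (latt (Matrix.diagonal ![ϖ ^ ((m + 1) / 2), (1 : K), ϖ ^ (-(m / 2))])) = latt (Matrix.diagonal ![ϖ ^ ((m + 1) / 2), (1 : K), ϖ ^ (-(m / 2))]) ∧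
          (latt (Matrix.diagonal ![ϖ ^ ((m + 1) / 2), (1 : K), ϖ ^ (-(m / 2))])).map ((Matrix.toLin' ((g' : Matrix (Fin 3) (Fin 3) K) - 1)).restrictScalars 𝒪[K]) ≤
            scaleLattice c (latt (Matrix.diagonal ![ϖ ^ ((m + 1) / 2), (1 : K), ϖ ^ (-(m / 2))])) := by
      intro g'; rw [Subgroup.mem_inf, hS g']
    rw [(mem_unitaryLevel_mapGL_iff σ hh hUM hU'w (h * g * h⁻¹)), inv_conj_conj, hUM g]
  -- (U7) on the standard apartment for the pulled-back groups
  have hV := fun (m : ℤ) (w : {M : Submodule 𝒪[K] (Fin 3 → K) // IsVertex σ ϖ ((StdForm.antidiagonal 3).over K) M}) (hw) => hmem w m hw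
  have hsub : ((U y).comap (MulAut.conj h).toMonoidHom : Set (GL (Fin 3) K)) ⊆
      ((U x).comap (MulAut.conj h).toMonoidHom : Set (GL (Fin 3) K)) * ((U z).comap (MulAut.conj h).toMonoidHom : Set (GL (Fin 3) K)) := by
    rcases hijk with ⟨hij, hjk⟩ | ⟨hkj, hji⟩
    · exact (unitaryLevel_subset_mul_of_between σ hc0 hc1 (apartmentWeight_ne_zero hϖ i) (apartmentWeight_ne_zero hϖ j) (apartmentWeight_ne_zero hϖ k)
        (apartmentWeight_lower_mono hϖ hjk) (apartmentWeight_upper_mono hϖ hij) (hV i x hx) (hV j y hy) (hV k z hz)).2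
    · exact (unitaryLevel_subset_mul_of_between σ hc0 hc1 (apartmentWeight_ne_zero hϖ k) (apartmentWeight_ne_zero hϖ j) (apartmentWeight_ne_zero hϖ i)
        (apartmentWeight_lower_mono hϖ hji) (apartmentWeight_upper_mono hϖ hkj) (hV k z hz) (hV j y hy) (hV i x hx)).1
  -- transport back by `conj h`
  refine subset_mul_of_forall_mem_iff_conj_mem h (fun g => ?_) (fun g => ?_) (fun g => ?_) hsub <;>
    rw [Subgroup.mem_comap, MulEquiv.coe_toMonoidHom, MulAut.conj_apply, conj_inv_conj]

/-! ## §3 The subtype form: subgroups of `↥U(σ, J)` (`J = Φ₃`), the currency of the datum `Gqs L v` -/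

omit [Valued K ℤᵐ⁰] in
/-- A product inclusion between images of subgroups of a subgroup-type `↥S` under `S.subtype` descends to `↥S`. [cite: SchneiderStuhler1997, Ch. I Prop. I.3.1 p. 118] -/
theorem subtype_subset_mul_of_map_subtype {G : Type*} [Group G] {S : Subgroup G} {A B C : Subgroup ↥S}
    (hsub : ((B.map S.subtype : Subgroup G) : Set G) ⊆ ((A.map S.subtype : Subgroup G) : Set G) * ((C.map S.subtype : Subgroup G) : Set G)) :
    (B : Set ↥S) ⊆ (A : Set ↥S) * (C : Set ↥S) := by
  intro γ hγ
  have hγ' : (γ : G) ∈ (B.map S.subtype : Subgroup G) := Subgroup.mem_map.2 ⟨γ, hγ, rfl⟩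
  obtain ⟨a, ha, b, hb, hab⟩ := Set.mem_mul.1 (hsub hγ')
  obtain ⟨α, hα, rfl⟩ := Subgroup.mem_map.1 ha
  obtain ⟨β, hβ, rfl⟩ := Subgroup.mem_map.1 hb
  refine Set.mem_mul.2 ⟨α, hα, β, hβ, Subtype.ext ?_⟩
  rw [Subgroup.coe_mul]
  exact hab

/-- **(U7) FROM AN APARTMENT WITNESS, SUBTYPE FORM**: the same as `unitaryLevel_subset_mul_of_apartment_witness` for a family `U` of subgroups of the subtype group `↥U(σ, J)`,
`J = Φ₃` (hypothesis `hJ`, the currency of ★ `borelTriple` ∕ the datum `Gqs L v`), with `hU : γ ∈ U x ↔ ↑γ·x = x ∧ (↑γ − 1)·x ⊆ c·x`.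
[cite: SchneiderStuhler1997, Ch. I Prop. I.3.1 p. 118] [cite: BruhatTits1972, §10] [cite: Korman2004, §3.6] -/
theorem unitaryLevel_subset_mul_of_apartment_witness_subtype {ϖ : K} (hϖ : Valued.v ϖ = WithZero.exp (-1 : ℤ)) {c : K} (hc0 : c ≠ 0) (hc1 : Valued.v c < 1)
    {J : Matrix (Fin 3) (Fin 3) K} (hJ : J = (StdForm.antidiagonal 3).over K)
    (U : {M : Submodule 𝒪[K] (Fin 3 → K) // IsVertex σ ϖ J M} → Subgroup ↥(unitaryGroupOfForm σ J))
    (hU : ∀ (x : {M : Submodule 𝒪[K] (Fin 3 → K) // IsVertex σ ϖ J M}) (γ : ↥(unitaryGroupOfForm σ J)),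
      γ ∈ U x ↔ mapGL (γ : GL (Fin 3) K) x.1 = x.1 ∧ x.1.map ((Matrix.toLin' (((γ : GL (Fin 3) K) : Matrix (Fin 3) (Fin 3) K) - 1)).restrictScalars 𝒪[K]) ≤ scaleLattice c x.1)
    {x y z : {M : Submodule 𝒪[K] (Fin 3 → K) // IsVertex σ ϖ J M}}
    (h : ↥(unitaryGroupOfForm σ J)) {i j k : ℤ} (hijk : i ≤ j ∧ j ≤ k ∨ k ≤ j ∧ j ≤ i)
    (hx : x.1 = mapGL (h : GL (Fin 3) K) (latt (Matrix.diagonal ![ϖ ^ ((i + 1) / 2), (1 : K), ϖ ^ (-(i / 2))])))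
    (hy : y.1 = mapGL (h : GL (Fin 3) K) (latt (Matrix.diagonal ![ϖ ^ ((j + 1) / 2), (1 : K), ϖ ^ (-(j / 2))])))
    (hz : z.1 = mapGL (h : GL (Fin 3) K) (latt (Matrix.diagonal ![ϖ ^ ((k + 1) / 2), (1 : K), ϖ ^ (-(k / 2))]))) :
    (U y : Set ↥(unitaryGroupOfForm σ J)) ⊆ (U x : Set ↥(unitaryGroupOfForm σ J)) * (U z : Set ↥(unitaryGroupOfForm σ J)) := by
  subst hJ
  refine subtype_subset_mul_of_map_subtype ?_
  have hmap : ∀ (w : {M : Submodule 𝒪[K] (Fin 3 → K) // IsVertex σ ϖ ((StdForm.antidiagonal 3).over K) M}) (g : GL (Fin 3) K),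
      g ∈ ((U w).map (unitaryGroupOfForm σ ((StdForm.antidiagonal 3).over K)).subtype : Subgroup (GL (Fin 3) K)) ↔
        g ∈ unitaryGroupOfForm σ ((StdForm.antidiagonal 3).over K) ∧ mapGL g w.1 = w.1 ∧
          w.1.map ((Matrix.toLin' ((g : Matrix (Fin 3) (Fin 3) K) - 1)).restrictScalars 𝒪[K]) ≤ scaleLattice c w.1 := by
    intro w g
    constructor
    · rintro hg
      obtain ⟨γ, hγ, rfl⟩ := Subgroup.mem_map.1 hg
      exact ⟨γ.2, (hU w γ).1 hγ⟩
    · rintro ⟨hgU, hrest⟩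
      exact Subgroup.mem_map.2 ⟨⟨g, hgU⟩, (hU w ⟨g, hgU⟩).2 hrest, rfl⟩
  exact unitaryLevel_subset_mul_of_apartment_witness σ hϖ hc0 hc1 (fun w => (U w).map (unitaryGroupOfForm σ ((StdForm.antidiagonal 3).over K)).subtype) hmap
    h.2 hijk hx hy hz

/-! ## §4 THE HEAD: (U7) geodesic inclusion for the unramified `U(3)` tree, in row 34's letters -/

/-- The enumerated apartment of ★ γ in the uniform spelling of ★ β §3: `(A m).1 = latt diag(ϖ^{⌊(m+1)/2⌋}, 1, ϖ^{−⌊m/2⌋})` for every `m : ℤ`. [cite: BruhatTits1972, §10] [cite: Serre1980Trees, Ch. II §1.1] -/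
theorem coe_apartmentEnum_eq_latt_diagonal_floor {ϖ : K}
    (A : ℤ → {M : Submodule 𝒪[K] (Fin 3 → K) // IsVertex σ ϖ ((StdForm.antidiagonal 3).over K) M})
    (hA0 : ∀ a : ℤ, (A (2 * a)).1 = latt (Matrix.diagonal ![ϖ ^ a, (1 : K), ϖ ^ (-a)]))
    (hA1 : ∀ a : ℤ, (A (2 * a + 1)).1 = latt (Matrix.diagonal ![ϖ ^ (a + 1), (1 : K), ϖ ^ (-a)])) (m : ℤ) :
    (A m).1 = latt (Matrix.diagonal ![ϖ ^ ((m + 1) / 2), (1 : K), ϖ ^ (-(m / 2))]) := by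
  obtain ⟨a, rfl | rfl⟩ := Int.even_or_odd' m
  · rw [hA0, show (2 * a + 1) / 2 = a by omega, show 2 * a / 2 = a by omega]
  · rw [hA1, show (2 * a + 1 + 1) / 2 = a + 1 by omega, show (2 * a + 1) / 2 = a by omega]

/-- **(U7) GEODESIC INCLUSION — THE HEAD** ([SS97] Prop. I.3.1 ∕ [Korman2004 §3.6 (U7)] for the lattice tree of `U(Φ₃)(K)`, `K∕K^σ` unramified; row 34's hypothesis `hU7` at the
datum): let `U` assign to every vertex of `latticeGraph σ ϖ Φ₃` its unitary level group at level `c` (`0 < |c| < 1`; hypothesis-style `hU`, rows 22∕22b with `c = ϖ^(e+1)`).  If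
`x ~ y` and `y` is the first step of the geodesic from `x` to `z` (`dist y z + 1 = dist x z`), then `U_y ⊆ U_x · U_z`.
[cite: SchneiderStuhler1997, Ch. I Prop. I.3.1 p. 118] [cite: Korman2004, §3.6] [cite: BruhatTits1972, (7.4.18)] -/
theorem unitaryLevel_subset_mul_of_adj_of_dist {ϖ : K} (hd : UnramifiedLocalConjDatum σ ϖ) {c : K} (hc0 : c ≠ 0) (hc1 : Valued.v c < 1)
    (U : {M : Submodule 𝒪[K] (Fin 3 → K) // IsVertex σ ϖ ((StdForm.antidiagonal 3).over K) M} → Subgroup (GL (Fin 3) K))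
    (hU : ∀ (x : {M : Submodule 𝒪[K] (Fin 3 → K) // IsVertex σ ϖ ((StdForm.antidiagonal 3).over K) M}) (g : GL (Fin 3) K),
      g ∈ U x ↔ g ∈ unitaryGroupOfForm σ ((StdForm.antidiagonal 3).over K) ∧ mapGL g x.1 = x.1 ∧
        x.1.map ((Matrix.toLin' ((g : Matrix (Fin 3) (Fin 3) K) - 1)).restrictScalars 𝒪[K]) ≤ scaleLattice c x.1)
    {x y z : {M : Submodule 𝒪[K] (Fin 3 → K) // IsVertex σ ϖ ((StdForm.antidiagonal 3).over K) M}}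
    (hxy : (latticeGraph σ ϖ ((StdForm.antidiagonal 3).over K)).Adj x y)
    (hyz : (latticeGraph σ ϖ ((StdForm.antidiagonal 3).over K)).dist y z + 1 = (latticeGraph σ ϖ ((StdForm.antidiagonal 3).over K)).dist x z) :
    (U y : Set (GL (Fin 3) K)) ⊆ (U x : Set (GL (Fin 3) K)) * (U z : Set (GL (Fin 3) K)) := by
  obtain ⟨A, hA0, hA1⟩ := exists_apartmentEnum hd
  obtain ⟨u, i, k, hik, hx, hy, hz⟩ := exists_latticeGraphIso_apartmentEnum_of_adj_of_dist hd A hA0 hA1 hxy hyz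
  refine unitaryLevel_subset_mul_of_apartment_witness σ hd.vϖ hc0 hc1 U hU u.2 (i := i) (j := i + 1) (k := k) (Or.inl ⟨by omega, hik⟩) ?_ ?_ ?_
  · rw [hx, ← coe_apartmentEnum_eq_latt_diagonal_floor σ A hA0 hA1]; rfl
  · rw [hy, ← coe_apartmentEnum_eq_latt_diagonal_floor σ A hA0 hA1]; rfl
  · rw [hz, ← coe_apartmentEnum_eq_latt_diagonal_floor σ A hA0 hA1]; rfl

/-- **(U7) GEODESIC INCLUSION — THE HEAD, SUBTYPE FORM** (the datum's currency `Γ = ↥U(σ, J)`, `J = Φ₃` as `hJ`; row 34's `hU7 : ∀ x y z, G.Adj x y → G.dist y z + 1 = G.dist x z →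
↑(U y) ⊆ ↑(U x) * ↑(U z)` with `U x = {γ : ↑γ·x = x ∧ (↑γ − 1)·x ⊆ c·x}`). [cite: SchneiderStuhler1997, Ch. I Prop. I.3.1 p. 118] [cite: Korman2004, §3.6] [cite: BruhatTits1972, (7.4.18)] -/
theorem unitaryLevel_subset_mul_of_adj_of_dist_subtype {ϖ : K} (hd : UnramifiedLocalConjDatum σ ϖ) {c : K} (hc0 : c ≠ 0) (hc1 : Valued.v c < 1)
    {J : Matrix (Fin 3) (Fin 3) K} (hJ : J = (StdForm.antidiagonal 3).over K)
    (U : {M : Submodule 𝒪[K] (Fin 3 → K) // IsVertex σ ϖ J M} → Subgroup ↥(unitaryGroupOfForm σ J))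
    (hU : ∀ (x : {M : Submodule 𝒪[K] (Fin 3 → K) // IsVertex σ ϖ J M}) (γ : ↥(unitaryGroupOfForm σ J)),
      γ ∈ U x ↔ mapGL (γ : GL (Fin 3) K) x.1 = x.1 ∧ x.1.map ((Matrix.toLin' (((γ : GL (Fin 3) K) : Matrix (Fin 3) (Fin 3) K) - 1)).restrictScalars 𝒪[K]) ≤ scaleLattice c x.1)
    {x y z : {M : Submodule 𝒪[K] (Fin 3 → K) // IsVertex σ ϖ J M}}
    (hxy : (latticeGraph σ ϖ J).Adj x y) (hyz : (latticeGraph σ ϖ J).dist y z + 1 = (latticeGraph σ ϖ J).dist x z) :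
    (U y : Set ↥(unitaryGroupOfForm σ J)) ⊆ (U x : Set ↥(unitaryGroupOfForm σ J)) * (U z : Set ↥(unitaryGroupOfForm σ J)) := by
  subst hJ
  obtain ⟨A, hA0, hA1⟩ := exists_apartmentEnum hd
  obtain ⟨u, i, k, hik, hx, hy, hz⟩ := exists_latticeGraphIso_apartmentEnum_of_adj_of_dist hd A hA0 hA1 hxy hyz
  refine unitaryLevel_subset_mul_of_apartment_witness_subtype σ hd.vϖ hc0 hc1 rfl U hU u (i := i) (j := i + 1) (k := k) (Or.inl ⟨by omega, hik⟩) ?_ ?_ ?_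
  · rw [hx, ← coe_apartmentEnum_eq_latt_diagonal_floor σ A hA0 hA1]; rfl
  · rw [hy, ← coe_apartmentEnum_eq_latt_diagonal_floor σ A hA0 hA1]; rfl
  · rw [hz, ← coe_apartmentEnum_eq_latt_diagonal_floor σ A hA0 hA1]; rfl

end Literature.NumberTheory.Automorphic.UnitaryLatticeTree

end
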